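import Literature.Barriers.NavierStokesRegularity.AveragedEquationStepTest
import Summits.NavierStokesRegularity.NavierStokesRegularity.Theorems.PerpetualPumpAveragedTypeIBlowupHolds
import HarnessLib

/-!
# The averaged-equation step test, unconditionally (Summits-side discharge)

The catalogue entry `Literature/Barriers/NavierStokesRegularity/AveragedEquationStepTest.lean`
states its tests from the hypotheses `(h : AveragedTypeIBlowup)` (Tests 2/2′ and the main
declaration `abstractTwoStepFails`) and `(h : Tao2016.exists_not_globalRegularity)` (Test 1),
because Literature does not import Summits. Both hypotheses are theorems of the tree:
`AveragedTypeIBlowup_holds` (this directory, `PerpetualPumpAveragedTypeIBlowupHolds.lean`, over the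
crux `PerpetualPump.AveragedTypeIBlowup`, stmt-NavierStokesRegularity-1835) and
`Tao2016.exists_not_globalRegularity_holds` (`TaoAveragedCascadeHolds.lean`, Tao 2016 Thm. 1.5).
This file plugs them in, so that refuters of the claims sweep (cell `ns-claims`, D-0090) have an
UNCONDITIONAL kernel interface: to show that a typed step `S : AveragingDatum → Prop` has no
averaging-insensitive proof, exhibit `S 𝒜 → GlobalRegularity 𝒜`, `S 𝒜 → NoBreakdown 𝒜` or
`S 𝒜 → ExcludesTypeI 𝒜` pointwise in the symmetric cancelling datum `𝒜` and apply the matching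
`…_holds` theorem below. No new mathematics; no `sorry`, standard axioms.

WHAT THIS IS NOT: not a claim about NS regularity or blow-up; not a claim about any author beyond the typed locator.
-/

set_option linter.dupNamespace false

noncomputable section

namespace Summit.NavierStokesRegularity.NavierStokesRegularity.Theorems

open scoped ENNReal
open Literature.Analysis.FluidPDE Literature.Analysis.FluidPDE.Tao2016
open Literature.Barriers.NavierStokesRegularity
open Literature.Barriers.NavierStokesRegularity.StepTest

/-- **Step test, main declaration, unconditionally:** for every slice functional `N`, the pair
«a priori bound on `N` along all `H¹⁰_df`-mild solutions ⊕ continuation under bounded `N`» is not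
averaging-insensitive over Tao's class (`abstractTwoStepFails` with `AveragedTypeIBlowup_holds`).
[cite: Tao2016AveragedNS, §1.1 Thm. 1.5 and pp. 6–8] -/
theorem abstractTwoStepFails_holds (N : L2C → ℝ≥0∞) :
    ¬ IsAveragingInsensitive fun 𝒜 => APrioriBound N 𝒜 ∧ ContinuesUnder N 𝒜 :=
  abstractTwoStepFails AveragedTypeIBlowup_holds N

/-- **Test 1, unconditionally:** a typed step implying global regularity of the averaged equation
it speaks about, pointwise in the symmetric cancelling datum, is not averaging-insensitive
(Tao 2016 Thm. 1.5, `exists_not_globalRegularity_holds`). [cite: Tao2016AveragedNS, §1.1 Thm. 1.5] -/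
theorem not_isAveragingInsensitive_of_imp_globalRegularity_holds {S : AveragingDatum → Prop}
    (hS : ∀ 𝒜 : AveragingDatum, 𝒜.IsSymmetric → 𝒜.HasCancellation → S 𝒜 → GlobalRegularity 𝒜) :
    ¬ IsAveragingInsensitive S :=
  not_isAveragingInsensitive_of_imp_globalRegularity exists_not_globalRegularity_holds hS

/-- **Test 2′, unconditionally:** a typed step implying that every local `H¹⁰_df`-mild solution of
the averaged equation it speaks about extends (`NoBreakdown`), pointwise in the symmetric cancelling
datum, is not averaging-insensitive (`AveragedTypeIBlowup_holds`). [cite: Tao2016AveragedNS, §1.1 Thm. 1.5 and p. 8] -/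
theorem not_isAveragingInsensitive_of_imp_noBreakdown_holds {S : AveragingDatum → Prop}
    (hS : ∀ 𝒜 : AveragingDatum, 𝒜.IsSymmetric → 𝒜.HasCancellation → S 𝒜 → NoBreakdown 𝒜) :
    ¬ IsAveragingInsensitive S :=
  not_isAveragingInsensitive_of_imp_noBreakdown AveragedTypeIBlowup_holds hS

/-- **Test 2, unconditionally:** a typed step implying Type-I exclusion for the averaged equation it
speaks about, pointwise in the symmetric cancelling datum, is not averaging-insensitive
(`AveragedTypeIBlowup_holds`). [cite: Tao2016AveragedNS, §1.1 p. 8 and footnote] -/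
theorem not_isAveragingInsensitive_of_imp_excludesTypeI_holds {S : AveragingDatum → Prop}
    (hS : ∀ 𝒜 : AveragingDatum, 𝒜.IsSymmetric → 𝒜.HasCancellation → S 𝒜 →
      AveragedTypeI.ExcludesTypeI 𝒜) :
    ¬ IsAveragingInsensitive S :=
  not_isAveragingInsensitive_of_imp_excludesTypeI AveragedTypeIBlowup_holds hS

/-- **One-sided step test, unconditionally ((C) given):** if continuation under bounded `N` holds
for every symmetric cancelling averaged equation, no averaging-insensitive argument bounds `N` a
priori along all solutions. [cite: Tao2016AveragedNS, §1.1 pp. 6–8] -/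
theorem not_isAveragingInsensitive_aprioriBound_holds {N : L2C → ℝ≥0∞}
    (hC : IsAveragingInsensitive (ContinuesUnder N)) : ¬ IsAveragingInsensitive (APrioriBound N) :=
  not_isAveragingInsensitive_aprioriBound AveragedTypeIBlowup_holds hC

/-- **One-sided step test, unconditionally ((A) given):** if an a priori bound on `N` holds for
every symmetric cancelling averaged equation, continuation under bounded `N` is not
averaging-insensitive. [cite: Tao2016AveragedNS, §1.1 pp. 6–8] -/
theorem not_isAveragingInsensitive_continuesUnder_holds {N : L2C → ℝ≥0∞}
    (hA : IsAveragingInsensitive (APrioriBound N)) : ¬ IsAveragingInsensitive (ContinuesUnder N) :=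
  not_isAveragingInsensitive_continuesUnder AveragedTypeIBlowup_holds hA

/-- For every `N`, some symmetric cancelling datum violates (A) or (C) — unconditionally.
[cite: Tao2016AveragedNS, §1.1 Thm. 1.5 and p. 8] -/
theorem exists_not_aprioriBound_or_not_continuesUnder_holds (N : L2C → ℝ≥0∞) :
    ∃ 𝒜 : AveragingDatum, 𝒜.IsSymmetric ∧ 𝒜.HasCancellation ∧
      (¬ APrioriBound N 𝒜 ∨ ¬ ContinuesUnder N 𝒜) :=
  exists_not_aprioriBound_or_not_continuesUnder AveragedTypeIBlowup_holds N

end Summit.NavierStokesRegularity.NavierStokesRegularity.Theorems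

end
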